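import Literature.NumberTheory.EllipticCurves.BinaryQuarticForms
import Mathlib.NumberTheory.Padics.Hensel
import Mathlib.NumberTheory.Padics.ProperSpace
import Mathlib.Topology.Algebra.Ring.Basic
import Mathlib.Topology.MetricSpace.Pseudo.Pi
import HarnessLib

/-!
# `ℚ_p`-solubility of binary quartic forms is locally constant off the discriminant locus

Topic `Literature/NumberTheory/EllipticCurves`; companion of `BinaryQuarticForms.lean` (vocabulary
of M. Bhargava, A. Shankar, *Binary quartic forms having bounded invariants, and the boundedness of
the average rank of elliptic curves*, Ann. of Math. (2) 181 (2015) 191–242).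

The sieve from all integral binary quartic forms to the locally soluble ones (the step of the proof
of Bhargava–Shankar's Theorem 1.1 vendored as
`Literature.NumberTheory.EllipticCurves.bhargavaShankar_locSolIrredClassCount_asymptotic`; in the
published version Thm 2.21 applied in the proof of Thm 3.19) runs over weight functions
`φ = ∏_p φ_p` whose local factors `φ_p : V_{ℤ_p} → [0,1]` must be *locally constant outside a
closed set of measure zero* ("defined by congruence conditions", published version §2.7); for the
`2`-Selmer count `φ_p` carries the indicator of the `ℚ_p`-soluble forms (those `f` for which
`z² = f(x,y)` has a nonzero solution over `ℚ_p`, §3.1 of the published version = §5.1 of the held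
arXiv text `arXiv:1006.1002v2`). This file proves the topological facts about `ℚ_p`-solubility
that this requires, for the space `V_{ℤ_p} = ℤ_p⁵` of binary quartic forms over `ℤ_p` with its
product (`p`-adic) topology:

* `BinaryQuartic.isClosed_setOf_isSoluble`: the set of `ℚ_p`-soluble forms is **closed** in
  `V_{ℤ_p}` (compactness of `ℙ¹(ℤ_p)` and of the set of squares);
* `BinaryQuartic.setOf_isSoluble_mem_nhds`: a `ℚ_p`-soluble form with nonzero discriminant has a
  **neighbourhood of `ℚ_p`-soluble forms** (Hensel's lemma: a solution with `z ≠ 0` persists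
  because nonzero squares are open; a solution with `z = 0` is a simple root of `f` in `ℙ¹(ℚ_p)`
  when `Δ(f) ≠ 0`, and simple roots persist);
* hence `BinaryQuartic.eventually_isSoluble_iff`: off the hypersurface `Δ = 0`, `ℚ_p`-solubility
  is **locally constant**, and in congruence form (`BinaryQuartic.exists_pow_dvd_imp_isSoluble_iff`,
  `BinaryQuartic.exists_pow_dvd_imp_isSoluble_iff_int`): for every `f` with `Δ(f) ≠ 0` there is
  `k` such that every form congruent to `f` modulo `p^k` is `ℚ_p`-soluble iff `f` is.

On the way: the topology on `BinaryQuartic R` (induced from `R⁵` by the coefficient map, a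
homeomorphism `homeomorphFin5`), continuity of evaluation, the normal form of `ℚ_p`-solubility of
a form over `ℤ_p` through the two affine charts of `ℙ¹(ℤ_p)` (`isSoluble_map_coe_iff`:
`z² = f(1,t)` or `z² = f(t,1)` with `t, z ∈ ℤ_p`), and the identity
`16·Δ(f) = U·∂f/∂x(t,1) + V·∂f/∂y(t,1)` with explicit integral cofactors `U`, `V`
(`sixteen_mul_disc_eq`), whence a form vanishing to order `2` at a point of `ℙ¹` has `Δ = 0`.

## References

* M. Bhargava, A. Shankar, Ann. of Math. (2) 181 (2015) 191–242, §2.7 ("defined by congruence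
  conditions", "acceptable") and §3.1–3.2 of the published version (= arXiv:1006.1002v3); §5.1 of
  the held arXiv text v2 (locally soluble forms). [cite: BhargavaShankarAnnals2015, §5.1 (arXiv:1006.1002v2 numbering)]
* Hensel's lemma for `ℤ_p` as in Mathlib (`hensels_lemma`, after K. Conrad's note).

## Design

* No new named facts; the only definitions are the coefficient vector `coeffs`, the equivalence /
  homeomorphism with `Fin 5 → R`, and the induced `TopologicalSpace` instance on `BinaryQuartic R`
  (the product topology of `V_R = R⁵`, the topology meant by "`p`-adic closure in `V_{ℤ_p}`" in the
  source). `ℚ_p`-solubility of `f : BinaryQuartic ℤ_[p]` is `(f.map PadicInt.Coe.ringHom).IsSoluble`,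
  and of an integral `f` it is `(f.map (Int.castRingHom ℚ_[p])).IsSoluble`, the `p`-component of
  `BinaryQuartic.IsLocallySoluble`.
-/

noncomputable section

open scoped Classical
open Filter Topology Polynomial

namespace Literature.NumberTheory.EllipticCurves

namespace BinaryQuartic

/-! ## The topology of `V_R = R⁵` -/

section Topology

variable {R : Type*}

/-- The coefficient vector `(a, b, c, d, e) ∈ R⁵` of `f = a x⁴ + b x³y + c x²y² + d xy³ + e y⁴`
(the coordinates of `V_R`, Bhargava–Shankar 2015, §2). [folklore] -/
def coeffs (f : BinaryQuartic R) : Fin 5 → R :=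
  ![f.a, f.b, f.c, f.d, f.e]

/-- Coordinate `0` is `a` (definitional). [folklore] -/
@[simp] theorem coeffs_zero (f : BinaryQuartic R) : f.coeffs 0 = f.a := rfl
/-- Coordinate `1` is `b` (definitional). [folklore] -/
@[simp] theorem coeffs_one (f : BinaryQuartic R) : f.coeffs 1 = f.b := rfl
/-- Coordinate `2` is `c` (definitional). [folklore] -/
@[simp] theorem coeffs_two (f : BinaryQuartic R) : f.coeffs 2 = f.c := rfl
/-- Coordinate `3` is `d` (definitional). [folklore] -/
@[simp] theorem coeffs_three (f : BinaryQuartic R) : f.coeffs 3 = f.d := rfl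
/-- Coordinate `4` is `e` (definitional). [folklore] -/
@[simp] theorem coeffs_four (f : BinaryQuartic R) : f.coeffs 4 = f.e := rfl

/-- `V_R ≃ R⁵` by the coefficient vector. [folklore] -/
def equivFin5 : BinaryQuartic R ≃ (Fin 5 → R) where
  toFun := coeffs
  invFun v := ⟨v 0, v 1, v 2, v 3, v 4⟩
  left_inv f := by cases f; rfl
  right_inv v := by
    funext i
    fin_cases i <;> rfl

/-- The coefficient map is injective: a form is determined by its coefficients. [folklore] -/
theorem coeffs_injective : Function.Injective (coeffs : BinaryQuartic R → Fin 5 → R) :=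
  equivFin5.injective

/-- The topology of `V_R = R⁵` on binary quartic forms: the one induced by the coefficient vector
from the product topology (for `R = ℤ_p` this is the `p`-adic topology in which Bhargava–Shankar
take "`p`-adic closures in `V_{ℤ_p}`", §2.5 and §5.2 of the held arXiv text). [folklore] -/
instance instTopologicalSpace [TopologicalSpace R] : TopologicalSpace (BinaryQuartic R) :=
  TopologicalSpace.induced coeffs inferInstance

variable [TopologicalSpace R]

/-- The coefficient map is a topological embedding (by definition of the topology). [folklore] -/
theorem isInducing_coeffs : IsInducing (coeffs : BinaryQuartic R → Fin 5 → R) :=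
  ⟨rfl⟩

/-- The coefficient map is continuous. [folklore] -/
@[fun_prop]
theorem continuous_coeffs : Continuous (coeffs : BinaryQuartic R → Fin 5 → R) :=
  isInducing_coeffs.continuous

/-- `V_R ≃ₜ R⁵`. [folklore] -/
def homeomorphFin5 : BinaryQuartic R ≃ₜ (Fin 5 → R) :=
  equivFin5.toHomeomorphOfIsInducing isInducing_coeffs

/-- The homeomorphism is the coefficient map (definitional). [folklore] -/
@[simp] theorem homeomorphFin5_apply (f : BinaryQuartic R) : homeomorphFin5 f = f.coeffs := rfl

/-- The coordinate `a` is continuous. [folklore] -/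
@[fun_prop] theorem continuous_a : Continuous fun f : BinaryQuartic R ↦ f.a :=
  (continuous_apply 0).comp continuous_coeffs
/-- The coordinate `b` is continuous. [folklore] -/
@[fun_prop] theorem continuous_b : Continuous fun f : BinaryQuartic R ↦ f.b :=
  (continuous_apply 1).comp continuous_coeffs
/-- The coordinate `c` is continuous. [folklore] -/
@[fun_prop] theorem continuous_c : Continuous fun f : BinaryQuartic R ↦ f.c :=
  (continuous_apply 2).comp continuous_coeffs
/-- The coordinate `d` is continuous. [folklore] -/
@[fun_prop] theorem continuous_d : Continuous fun f : BinaryQuartic R ↦ f.d :=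
  (continuous_apply 3).comp continuous_coeffs
/-- The coordinate `e` is continuous. [folklore] -/
@[fun_prop] theorem continuous_e : Continuous fun f : BinaryQuartic R ↦ f.e :=
  (continuous_apply 4).comp continuous_coeffs

/-- A map into `V_R` is continuous iff its five coefficient functions are. [folklore] -/
theorem continuous_iff {X : Type*} [TopologicalSpace X] (g : X → BinaryQuartic R) :
    Continuous g ↔ (Continuous fun x ↦ (g x).a) ∧ (Continuous fun x ↦ (g x).b) ∧
      (Continuous fun x ↦ (g x).c) ∧ (Continuous fun x ↦ (g x).d) ∧
        (Continuous fun x ↦ (g x).e) := by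
  constructor
  · intro h
    exact ⟨continuous_a.comp h, continuous_b.comp h, continuous_c.comp h, continuous_d.comp h,
      continuous_e.comp h⟩
  · rintro ⟨ha, hb, hc, hd, he⟩
    rw [isInducing_coeffs.continuous_iff, continuous_pi_iff]
    intro i
    fin_cases i
    exacts [ha, hb, hc, hd, he]

/-- The reversal `f(x,y) ↦ f(y,x)` is continuous. [folklore] -/
theorem continuous_reverse :
    Continuous fun f : BinaryQuartic R ↦ (⟨f.e, f.d, f.c, f.b, f.a⟩ : BinaryQuartic R) := by
  rw [continuous_iff]
  exact ⟨continuous_e, continuous_d, continuous_c, continuous_b, continuous_a⟩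

variable [CommRing R] [IsTopologicalRing R]

/-- Evaluation `(f, x, y) ↦ f(x, y)` is continuous on `V_R × R × R`. [folklore] -/
@[fun_prop]
theorem continuous_eval :
    Continuous fun q : BinaryQuartic R × R × R ↦ q.1.eval q.2.1 q.2.2 := by
  simp only [eval]
  fun_prop

/-- The discriminant is a continuous function on `V_R`. [folklore] -/
@[fun_prop]
theorem continuous_disc : Continuous fun f : BinaryQuartic R ↦ f.disc := by
  simp only [disc]
  fun_prop

end Topology

/-! ## Algebraic identities -/

section Algebra

variable {R : Type*} [CommRing R]

/-- Homogeneity: `f(λx, λy) = λ⁴ f(x, y)` (a private copy of `BinaryQuartic.eval_mul_mul` of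
`BhargavaShankarCountingProofs`, to keep this file's imports light). [folklore] -/
private theorem eval_homog (f : BinaryQuartic R) (l x y : R) :
    f.eval (l * x) (l * y) = l ^ 4 * f.eval x y := by
  simp only [eval]; ring

/-- `f(y, x)` is the value of the reversed form `(e, d, c, b, a)` at `(x, y)`. [folklore] -/
theorem eval_reverse (f : BinaryQuartic R) (x y : R) :
    (⟨f.e, f.d, f.c, f.b, f.a⟩ : BinaryQuartic R).eval x y = f.eval y x := by
  simp only [eval]; ring

/-- Reversal commutes with change of ring. [folklore] -/
theorem map_reverse {S : Type*} [CommRing S] (φ : R →+* S) (f : BinaryQuartic R) :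
    (⟨f.e, f.d, f.c, f.b, f.a⟩ : BinaryQuartic R).map φ = ⟨φ f.e, φ f.d, φ f.c, φ f.b, φ f.a⟩ :=
  rfl

/-- Reversal preserves the discriminant (a private copy of `BinaryQuartic.disc_reverse` of
`BhargavaShankarEq31FrontierProofs`, not imported to keep this file low in the import graph).
[folklore] -/
private theorem disc_reverse_eq (f : BinaryQuartic R) :
    (⟨f.e, f.d, f.c, f.b, f.a⟩ : BinaryQuartic R).disc = f.disc := by
  simp only [disc]; ring

/-- `f(x,1)` is the value of the dehomogenised polynomial `toPoly f` (a private copy of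
`BinaryQuartic.eval_toPoly` of `BhargavaShankarCountingProofs`). [folklore] -/
private theorem toPoly_eval (f : BinaryQuartic R) (t : R) : f.toPoly.eval t = f.eval t 1 := by
  simp only [toPoly, eval, Polynomial.eval_add, Polynomial.eval_mul, Polynomial.eval_C,
    Polynomial.eval_pow, Polynomial.eval_X]
  ring

/-- The derivative of `f(t,1)` in `t` is `∂f/∂x (t,1) = 4a t³ + 3b t² + 2c t + d`. [folklore] -/
theorem eval_derivative_toPoly (f : BinaryQuartic R) (t : R) :
    f.toPoly.derivative.eval t = 4 * f.a * t ^ 3 + 3 * f.b * t ^ 2 + 2 * f.c * t + f.d := by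
  simp [toPoly]
  ring

/-- **`16·Δ(f) = U(t)·∂f/∂x(t,1) + V(t)·∂f/∂y(t,1)`** with explicit cofactors `U, V ∈ ℤ[a,b,c,d,e][t]`
(the Bézout identity behind `Res(∂f/∂x, ∂f/∂y) = 16·Δ(f)` for binary quartics): in particular a
common zero of the two partial derivatives forces `16·Δ(f) = 0`. [folklore] -/
theorem sixteen_mul_disc_eq (f : BinaryQuartic R) (t : R) :
    16 * f.disc =
      (128 * f.a ^ 2 * f.b * f.c * f.e * t ^ 2 - 144 * f.a ^ 2 * f.b * f.d ^ 2 * t ^ 2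
        + 192 * f.a ^ 2 * f.b * f.d * f.e * t - 256 * f.a ^ 2 * f.b * f.e ^ 2
        + 256 * f.a ^ 2 * f.c ^ 2 * f.e * t - 288 * f.a ^ 2 * f.c * f.d ^ 2 * t
        + 768 * f.a ^ 2 * f.c * f.d * f.e - 432 * f.a ^ 2 * f.d ^ 3 - 48 * f.a * f.b ^ 3 * f.e * t ^ 2
        + 112 * f.a * f.b ^ 2 * f.c * f.d * t ^ 2 - 224 * f.a * f.b ^ 2 * f.c * f.e * t
        - 12 * f.a * f.b ^ 2 * f.d ^ 2 * t - 112 * f.a * f.b ^ 2 * f.d * f.e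
        - 32 * f.a * f.b * f.c ^ 3 * t ^ 2 + 240 * f.a * f.b * f.c ^ 2 * f.d * t
        - 192 * f.a * f.b * f.c ^ 2 * f.e + 288 * f.a * f.b * f.c * f.d ^ 2 - 64 * f.a * f.c ^ 4 * t
        - 64 * f.a * f.c ^ 3 * f.d - 24 * f.b ^ 4 * f.d * t ^ 2 + 36 * f.b ^ 4 * f.e * t
        + 8 * f.b ^ 3 * f.c ^ 2 * t ^ 2 - 52 * f.b ^ 3 * f.c * f.d * t + 48 * f.b ^ 3 * f.c * f.e
        - 64 * f.b ^ 3 * f.d ^ 2 + 16 * f.b ^ 2 * f.c ^ 3 * t + 16 * f.b ^ 2 * f.c ^ 2 * f.d) *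
          (4 * f.a * t ^ 3 + 3 * f.b * t ^ 2 + 2 * f.c * t + f.d) +
      (-512 * f.a ^ 3 * f.c * f.e * t ^ 2 + 576 * f.a ^ 3 * f.d ^ 2 * t ^ 2
        - 768 * f.a ^ 3 * f.d * f.e * t + 1024 * f.a ^ 3 * f.e ^ 2 + 192 * f.a ^ 2 * f.b ^ 2 * f.e * t ^ 2
        - 448 * f.a ^ 2 * f.b * f.c * f.d * t ^ 2 + 128 * f.a ^ 2 * f.b * f.c * f.e * t
        + 480 * f.a ^ 2 * f.b * f.d ^ 2 * t - 704 * f.a ^ 2 * f.b * f.d * f.e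
        + 128 * f.a ^ 2 * f.c ^ 3 * t ^ 2 - 64 * f.a ^ 2 * f.c ^ 2 * f.d * t
        - 512 * f.a ^ 2 * f.c ^ 2 * f.e + 384 * f.a ^ 2 * f.c * f.d ^ 2 + 96 * f.a * f.b ^ 3 * f.d * t ^ 2
        - 32 * f.a * f.b ^ 2 * f.c ^ 2 * t ^ 2 - 320 * f.a * f.b ^ 2 * f.c * f.d * t
        + 576 * f.a * f.b ^ 2 * f.c * f.e + 4 * f.a * f.b ^ 2 * f.d ^ 2 + 96 * f.a * f.b * f.c ^ 3 * t
        - 272 * f.a * f.b * f.c ^ 2 * f.d + 64 * f.a * f.c ^ 4 + 72 * f.b ^ 4 * f.d * t - 108 * f.b ^ 4 * f.e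
        - 24 * f.b ^ 3 * f.c ^ 2 * t + 60 * f.b ^ 3 * f.c * f.d - 16 * f.b ^ 2 * f.c ^ 3) *
          (f.b * t ^ 3 + 2 * f.c * t ^ 2 + 3 * f.d * t + 4 * f.e) := by
  simp only [disc]; ring

/-- Euler's identity at `(t, 1)`: `∂f/∂y(t,1) = 4 f(t,1) − t · ∂f/∂x(t,1)`. [folklore] -/
theorem euler_identity (f : BinaryQuartic R) (t : R) :
    f.b * t ^ 3 + 2 * f.c * t ^ 2 + 3 * f.d * t + 4 * f.e =
      4 * f.eval t 1 - t * (4 * f.a * t ^ 3 + 3 * f.b * t ^ 2 + 2 * f.c * t + f.d) := by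
  simp only [eval]; ring

/-- Over a domain of characteristic zero: if `f(t,1) = 0` and `∂f/∂x(t,1) = 0` (a multiple root of
`f` at `[t : 1] ∈ ℙ¹`), then `Δ(f) = 0`. [folklore] -/
theorem disc_eq_zero_of_eval_eq_zero_of_deriv_eq_zero [IsDomain R] [CharZero R] (f : BinaryQuartic R)
    {t : R} (h0 : f.eval t 1 = 0)
    (h1 : 4 * f.a * t ^ 3 + 3 * f.b * t ^ 2 + 2 * f.c * t + f.d = 0) : f.disc = 0 := by
  have h2 : f.b * t ^ 3 + 2 * f.c * t ^ 2 + 3 * f.d * t + 4 * f.e = 0 := by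
    rw [euler_identity, h0, h1]; ring
  have h := sixteen_mul_disc_eq f t
  rw [h1, h2, mul_zero, mul_zero, add_zero] at h
  have h16 : (16 : R) ≠ 0 := by exact_mod_cast (by norm_num : (16 : ℕ) ≠ 0)
  exact (mul_eq_zero.mp h).resolve_left h16

end Algebra

/-- Swapping the variables preserves solubility: `z² = f(y,x)` iff `z² = f(x,y)` is soluble. [folklore] -/
theorem isSoluble_reverse_iff {K : Type*} [CommRing K] (g : BinaryQuartic K) :
    (⟨g.e, g.d, g.c, g.b, g.a⟩ : BinaryQuartic K).IsSoluble ↔ g.IsSoluble := by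
  constructor
  · rintro ⟨x, y, z, hxy, h⟩
    exact ⟨y, x, z, hxy.symm, by rw [h, eval_reverse]⟩
  · rintro ⟨x, y, z, hxy, h⟩
    exact ⟨y, x, z, hxy.symm, by rw [h, eval_reverse]⟩

/-! ## `ℚ_p`-solubility of forms over `ℤ_p`: the two affine charts -/

section Padic

variable {p : ℕ} [Fact p.Prime]

/-- Evaluation commutes with `ℤ_p ⊆ ℚ_p`. [folklore] -/
theorem coe_eval (f : BinaryQuartic ℤ_[p]) (x y : ℤ_[p]) :
    ((f.eval x y : ℤ_[p]) : ℚ_[p]) = (f.map PadicInt.Coe.ringHom).eval (x : ℚ_[p]) (y : ℚ_[p]) := by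
  have := eval_map (PadicInt.Coe.ringHom (p := p)) f x y
  simpa only [PadicInt.Coe.ringHom_apply] using this.symm

/-- A `ℤ_p`-point gives `ℚ_p`-solubility: if `z² = f(x,y)` with `x, y, z ∈ ℤ_p`, `(x,y) ≠ (0,0)`,
then `f` is `ℚ_p`-soluble. [folklore] -/
theorem isSoluble_map_coe_of_eval_eq_sq (f : BinaryQuartic ℤ_[p]) {x y z : ℤ_[p]}
    (hxy : x ≠ 0 ∨ y ≠ 0) (h : z ^ 2 = f.eval x y) : (f.map PadicInt.Coe.ringHom).IsSoluble := by
  refine ⟨x, y, z, ?_, ?_⟩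
  · rcases hxy with hx | hy
    · exact Or.inl (PadicInt.coe_ne_zero.mpr hx)
    · exact Or.inr (PadicInt.coe_ne_zero.mpr hy)
  · rw [← coe_eval, ← h, PadicInt.coe_pow]

/-- **Normal form of `ℚ_p`-solubility through the two affine charts of `ℙ¹(ℤ_p)`.** A form `f`
over `ℤ_p` is `ℚ_p`-soluble iff `z² = f(1, t)` or `z² = f(t, 1)` has a solution with
`t, z ∈ ℤ_p` (scale a solution `(x, y, z)` by `λ = x⁻¹` or `y⁻¹`, whichever makes both
coordinates integral; then `z` is integral too). [folklore] -/
theorem isSoluble_map_coe_iff (f : BinaryQuartic ℤ_[p]) :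
    (f.map PadicInt.Coe.ringHom).IsSoluble ↔
      (∃ t z : ℤ_[p], z ^ 2 = f.eval 1 t) ∨ (∃ t z : ℤ_[p], z ^ 2 = f.eval t 1) := by
  constructor
  · rintro ⟨x, y, z, hxy, hz⟩
    rcases le_or_gt ‖y‖ ‖x‖ with hyx | hxy'
    · -- the chart `x ≠ 0`: `(1, y/x)`
      have hx : x ≠ 0 := by
        rintro rfl
        rcases hxy with h | h
        · exact h rfl
        · exact h (by simpa using hyx)
      left
      have ht : ‖y / x‖ ≤ 1 := by
        rw [norm_div]; exact div_le_one_of_le₀ hyx (norm_nonneg _)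
      have key : (z / x ^ 2) ^ 2 = (f.map PadicInt.Coe.ringHom).eval 1 (y / x) := by
        have h1 : (f.map PadicInt.Coe.ringHom).eval 1 (y / x) =
            (f.map PadicInt.Coe.ringHom).eval (x⁻¹ * x) (x⁻¹ * y) := by
          rw [inv_mul_cancel₀ hx, div_eq_inv_mul]
        rw [h1, eval_homog, ← hz]
        field_simp
      have hval : (f.map PadicInt.Coe.ringHom).eval 1 (y / x) =
          ((f.eval 1 ⟨y / x, ht⟩ : ℤ_[p]) : ℚ_[p]) := by
        rw [coe_eval]; rfl
      have hw : ‖z / x ^ 2‖ ≤ 1 := by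
        have h2 : ‖z / x ^ 2‖ ^ 2 ≤ 1 := by
          rw [← norm_pow, key, hval, ← PadicInt.norm_def]
          exact PadicInt.norm_le_one _
        exact (sq_le_one_iff₀ (norm_nonneg _)).mp h2
      refine ⟨⟨y / x, ht⟩, ⟨z / x ^ 2, hw⟩, PadicInt.ext ?_⟩
      rw [PadicInt.coe_pow, ← hval, ← key]
    · -- the chart `y ≠ 0`: `(x/y, 1)`
      have hy : y ≠ 0 := by
        rintro rfl
        rw [norm_zero] at hxy'
        exact (norm_nonneg x).not_gt hxy'
      right
      have ht : ‖x / y‖ ≤ 1 := by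
        rw [norm_div]; exact div_le_one_of_le₀ hxy'.le (norm_nonneg _)
      have key : (z / y ^ 2) ^ 2 = (f.map PadicInt.Coe.ringHom).eval (x / y) 1 := by
        have h1 : (f.map PadicInt.Coe.ringHom).eval (x / y) 1 =
            (f.map PadicInt.Coe.ringHom).eval (y⁻¹ * x) (y⁻¹ * y) := by
          rw [inv_mul_cancel₀ hy, div_eq_inv_mul]
        rw [h1, eval_homog, ← hz]
        field_simp
      have hval : (f.map PadicInt.Coe.ringHom).eval (x / y) 1 =
          ((f.eval ⟨x / y, ht⟩ 1 : ℤ_[p]) : ℚ_[p]) := by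
        rw [coe_eval]; rfl
      have hw : ‖z / y ^ 2‖ ≤ 1 := by
        have h2 : ‖z / y ^ 2‖ ^ 2 ≤ 1 := by
          rw [← norm_pow, key, hval, ← PadicInt.norm_def]
          exact PadicInt.norm_le_one _
        exact (sq_le_one_iff₀ (norm_nonneg _)).mp h2
      refine ⟨⟨x / y, ht⟩, ⟨z / y ^ 2, hw⟩, PadicInt.ext ?_⟩
      rw [PadicInt.coe_pow, ← hval, ← key]
  · rintro (⟨t, z, h⟩ | ⟨t, z, h⟩)
    · exact isSoluble_map_coe_of_eval_eq_sq f (Or.inl one_ne_zero) h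
    · exact isSoluble_map_coe_of_eval_eq_sq f (Or.inr one_ne_zero) h

/-! ## Closedness -/

/-- The squares form a closed subset of `ℤ_p` (a continuous image of a compact space). [folklore] -/
theorem isClosed_range_sq : IsClosed (Set.range fun z : ℤ_[p] ↦ z ^ 2) :=
  (isCompact_range (continuous_pow 2)).isClosed

/-- **The `ℚ_p`-soluble forms form a closed subset of `V_{ℤ_p}`.** (By the normal form, the
soluble set is the projection to `V_{ℤ_p}` of the closed set
`{(f, t) : f(1,t) ∈ ℤ_p²} ∪ {(f, t) : f(t,1) ∈ ℤ_p²}` along the compact factor `ℤ_p`.) [folklore] -/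
theorem isClosed_setOf_isSoluble :
    IsClosed {f : BinaryQuartic ℤ_[p] | (f.map PadicInt.Coe.ringHom).IsSoluble} := by
  set A₁ : Set (BinaryQuartic ℤ_[p] × ℤ_[p]) :=
    {q | q.1.eval 1 q.2 ∈ Set.range fun z : ℤ_[p] ↦ z ^ 2} with hA₁
  set A₂ : Set (BinaryQuartic ℤ_[p] × ℤ_[p]) :=
    {q | q.1.eval q.2 1 ∈ Set.range fun z : ℤ_[p] ↦ z ^ 2} with hA₂
  have hc₁ : Continuous fun q : BinaryQuartic ℤ_[p] × ℤ_[p] ↦ q.1.eval 1 q.2 := by fun_prop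
  have hc₂ : Continuous fun q : BinaryQuartic ℤ_[p] × ℤ_[p] ↦ q.1.eval q.2 1 := by fun_prop
  have h1 : IsClosed (Prod.fst '' A₁) :=
    isClosedMap_fst_of_compactSpace _ (isClosed_range_sq.preimage hc₁)
  have h2 : IsClosed (Prod.fst '' A₂) :=
    isClosedMap_fst_of_compactSpace _ (isClosed_range_sq.preimage hc₂)
  have hS : {f : BinaryQuartic ℤ_[p] | (f.map PadicInt.Coe.ringHom).IsSoluble} =
      Prod.fst '' A₁ ∪ Prod.fst '' A₂ := by
    ext f
    rw [Set.mem_setOf_eq, isSoluble_map_coe_iff, Set.mem_union]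
    constructor
    · rintro (⟨t, z, h⟩ | ⟨t, z, h⟩)
      · exact Or.inl ⟨(f, t), ⟨z, h⟩, rfl⟩
      · exact Or.inr ⟨(f, t), ⟨z, h⟩, rfl⟩
    · rintro (⟨⟨f', t⟩, ⟨z, h⟩, rfl⟩ | ⟨⟨f', t⟩, ⟨z, h⟩, rfl⟩)
      · exact Or.inl ⟨t, z, h⟩
      · exact Or.inr ⟨t, z, h⟩
  rw [hS]
  exact h1.union h2

/-! ## Openness at forms of nonzero discriminant (Hensel) -/

/-- **Nonzero squares are open in `ℤ_p`** (Hensel): if `‖z² − w‖ < ‖2z‖²` then `w` is a square.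
[folklore] -/
theorem exists_sq_eq_of_norm_sub_lt {z w : ℤ_[p]} (h : ‖z ^ 2 - w‖ < ‖2 * z‖ ^ 2) :
    ∃ z' : ℤ_[p], z' ^ 2 = w := by
  have h1 : (X ^ 2 - C w : ℤ_[p][X]).aeval z = z ^ 2 - w := by
    rw [Polynomial.coe_aeval_eq_eval, Polynomial.eval_sub, Polynomial.eval_pow, Polynomial.eval_X,
      Polynomial.eval_C]
  have h2 : (derivative (X ^ 2 - C w : ℤ_[p][X])).aeval z = 2 * z := by
    rw [Polynomial.coe_aeval_eq_eval, Polynomial.derivative_sub, Polynomial.derivative_X_sq,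
      Polynomial.derivative_C, sub_zero, Polynomial.eval_mul, Polynomial.eval_C, Polynomial.eval_X]
  have hnorm : ‖(X ^ 2 - C w : ℤ_[p][X]).aeval z‖ <
      ‖(derivative (X ^ 2 - C w : ℤ_[p][X])).aeval z‖ ^ 2 := by
    rw [h1, h2]; exact h
  obtain ⟨z', hz', -⟩ := hensels_lemma hnorm
  rw [Polynomial.coe_aeval_eq_eval, Polynomial.eval_sub, Polynomial.eval_pow, Polynomial.eval_X,
    Polynomial.eval_C, sub_eq_zero] at hz'
  exact ⟨z', hz'⟩

/-- **Simple roots persist** (Hensel): if `‖G(t)‖ < ‖F'(t)‖²` and `‖G'(t) − F'(t)‖ < ‖F'(t)‖`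
(so that `‖G'(t)‖ = ‖F'(t)‖ ≠ 0`), then `G` has a root in `ℤ_p`. [folklore] -/
theorem exists_eval_eq_zero_of_norm_lt {F G : ℤ_[p][X]} {t : ℤ_[p]}
    (h1 : ‖G.eval t‖ < ‖F.derivative.eval t‖ ^ 2)
    (h2 : ‖G.derivative.eval t - F.derivative.eval t‖ < ‖F.derivative.eval t‖) :
    ∃ t' : ℤ_[p], G.eval t' = 0 := by
  have h3 : ‖G.derivative.eval t‖ = ‖F.derivative.eval t‖ := by
    have := PadicInt.norm_add_eq_max_of_ne h2.ne
    rw [sub_add_cancel] at this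
    rw [this, max_eq_right h2.le]
  have hnorm : ‖G.aeval t‖ < ‖G.derivative.aeval t‖ ^ 2 := by
    simp only [Polynomial.coe_aeval_eq_eval]
    rw [h3]; exact h1
  obtain ⟨t', ht', -⟩ := hensels_lemma hnorm
  exact ⟨t', by simpa [Polynomial.coe_aeval_eq_eval] using ht'⟩

/-- The chart case: a solution `z² = f(t, 1)` of a form with `Δ(f) ≠ 0` propagates to a
neighbourhood of `f` in `V_{ℤ_p}` — through `exists_sq_eq_of_norm_sub_lt` if `z ≠ 0`, and through
`exists_eval_eq_zero_of_norm_lt` if `z = 0` (then `t` is a simple root of `f(·,1)` as `Δ(f) ≠ 0`).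
[folklore] -/
theorem setOf_isSoluble_mem_nhds_of_sq_eq_eval (f : BinaryQuartic ℤ_[p]) (hΔ : f.disc ≠ 0)
    {t z : ℤ_[p]} (h : z ^ 2 = f.eval t 1) :
    {g : BinaryQuartic ℤ_[p] | (g.map PadicInt.Coe.ringHom).IsSoluble} ∈ 𝓝 f := by
  by_cases hz : z = 0
  · subst hz
    have h0 : f.eval t 1 = 0 := by rw [← h]; ring
    have hd : f.toPoly.derivative.eval t ≠ 0 := by
      intro hd
      rw [eval_derivative_toPoly] at hd
      exact hΔ (disc_eq_zero_of_eval_eq_zero_of_deriv_eq_zero f h0 hd)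
    have hδ : 0 < ‖f.toPoly.derivative.eval t‖ := norm_pos_iff.mpr hd
    have hc1 : Continuous fun g : BinaryQuartic ℤ_[p] ↦ ‖g.toPoly.eval t‖ := by
      simp only [toPoly_eval]; fun_prop
    have hc2 : Continuous fun g : BinaryQuartic ℤ_[p] ↦
        ‖g.toPoly.derivative.eval t - f.toPoly.derivative.eval t‖ := by
      simp only [eval_derivative_toPoly]; fun_prop
    have hU : {g : BinaryQuartic ℤ_[p] | ‖g.toPoly.eval t‖ < ‖f.toPoly.derivative.eval t‖ ^ 2} ∩
        {g : BinaryQuartic ℤ_[p] | ‖g.toPoly.derivative.eval t - f.toPoly.derivative.eval t‖ <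
          ‖f.toPoly.derivative.eval t‖} ∈ 𝓝 f := by
      refine ((isOpen_lt hc1 continuous_const).inter (isOpen_lt hc2 continuous_const)).mem_nhds ?_
      refine ⟨?_, ?_⟩
      · simp only [Set.mem_setOf_eq, toPoly_eval, h0, norm_zero]
        exact pow_pos hδ 2
      · simp only [Set.mem_setOf_eq, sub_self, norm_zero]
        exact hδ
    refine mem_of_superset hU ?_
    rintro g ⟨hg1, hg2⟩
    obtain ⟨t', ht'⟩ := exists_eval_eq_zero_of_norm_lt hg1 hg2
    rw [toPoly_eval] at ht'
    exact isSoluble_map_coe_of_eval_eq_sq g (Or.inr one_ne_zero) (z := 0) (by rw [ht']; ring)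
  · have h2z : (2 : ℤ_[p]) * z ≠ 0 := mul_ne_zero two_ne_zero hz
    have hc : Continuous fun g : BinaryQuartic ℤ_[p] ↦ ‖f.eval t 1 - g.eval t 1‖ := by fun_prop
    have hU : {g : BinaryQuartic ℤ_[p] | ‖f.eval t 1 - g.eval t 1‖ < ‖2 * z‖ ^ 2} ∈ 𝓝 f := by
      refine (isOpen_lt hc continuous_const).mem_nhds ?_
      simp only [Set.mem_setOf_eq, sub_self, norm_zero]
      exact pow_pos (norm_pos_iff.mpr h2z) 2
    refine mem_of_superset hU ?_
    intro g hg
    obtain ⟨z', hz'⟩ := exists_sq_eq_of_norm_sub_lt (z := z) (w := g.eval t 1) (by rwa [h])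
    exact isSoluble_map_coe_of_eval_eq_sq g (Or.inr one_ne_zero) hz'

/-- **A `ℚ_p`-soluble form with `Δ ≠ 0` has a neighbourhood of `ℚ_p`-soluble forms in `V_{ℤ_p}`.**
[folklore] -/
theorem setOf_isSoluble_mem_nhds (f : BinaryQuartic ℤ_[p]) (hΔ : f.disc ≠ 0)
    (hs : (f.map PadicInt.Coe.ringHom).IsSoluble) :
    {g : BinaryQuartic ℤ_[p] | (g.map PadicInt.Coe.ringHom).IsSoluble} ∈ 𝓝 f := by
  rcases (isSoluble_map_coe_iff f).mp hs with ⟨t, z, h⟩ | ⟨t, z, h⟩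
  · -- chart `(1, t)`: pass to the reversed form `f(y, x)`
    have hrev : {g : BinaryQuartic ℤ_[p] | (g.map PadicInt.Coe.ringHom).IsSoluble} ∈
        𝓝 (⟨f.e, f.d, f.c, f.b, f.a⟩ : BinaryQuartic ℤ_[p]) := by
      refine setOf_isSoluble_mem_nhds_of_sq_eq_eval _ ?_ (t := t) (z := z) ?_
      · rwa [disc_reverse_eq]
      · rw [h, eval_reverse]
    have hpre := continuous_reverse.continuousAt.preimage_mem_nhds hrev
    refine mem_of_superset hpre ?_
    intro g hg
    simp only [Set.mem_preimage, Set.mem_setOf_eq, map_reverse] at hg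
    exact (isSoluble_reverse_iff (g.map PadicInt.Coe.ringHom)).mp hg
  · exact setOf_isSoluble_mem_nhds_of_sq_eq_eval f hΔ h

/-- The set of `ℚ_p`-soluble forms with nonzero discriminant is open in `V_{ℤ_p}`. [folklore] -/
theorem isOpen_setOf_isSoluble_and_disc_ne_zero :
    IsOpen {f : BinaryQuartic ℤ_[p] | (f.map PadicInt.Coe.ringHom).IsSoluble ∧ f.disc ≠ 0} := by
  rw [isOpen_iff_mem_nhds]
  rintro f ⟨hs, hΔ⟩
  have h1 := setOf_isSoluble_mem_nhds f hΔ hs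
  have h2 : {g : BinaryQuartic ℤ_[p] | g.disc ≠ 0} ∈ 𝓝 f :=
    (isOpen_ne_fun continuous_disc continuous_const).mem_nhds hΔ
  exact Filter.inter_mem h1 h2

/-! ## Local constancy off `Δ = 0` -/

/-- **`ℚ_p`-solubility is locally constant on `{Δ ≠ 0} ⊆ V_{ℤ_p}`**: near a form `f` with
`Δ(f) ≠ 0`, a form is `ℚ_p`-soluble iff `f` is (openness at soluble `f`; closedness of the soluble
set at insoluble `f`). This is the regularity of the local solubility condition used for the weights
of the `2`-Selmer sieve (Bhargava–Shankar 2015, published version §2.7 and proof of Thm 3.19: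
`φ_p` "locally constant outside some closed set of measure zero"). [cite: BhargavaShankarAnnals2015, §5.1–5.2 (locally soluble forms, p-adic closures in V_{ℤ_p}; arXiv:1006.1002v2 numbering)] -/
theorem eventually_isSoluble_iff (f : BinaryQuartic ℤ_[p]) (hΔ : f.disc ≠ 0) :
    ∀ᶠ g in 𝓝 f,
      (g.map PadicInt.Coe.ringHom).IsSoluble ↔ (f.map PadicInt.Coe.ringHom).IsSoluble := by
  by_cases hs : (f.map PadicInt.Coe.ringHom).IsSoluble
  · filter_upwards [setOf_isSoluble_mem_nhds f hΔ hs] with g hg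
    exact iff_of_true hg hs
  · have hc : {g : BinaryQuartic ℤ_[p] | (g.map PadicInt.Coe.ringHom).IsSoluble}ᶜ ∈ 𝓝 f :=
      isClosed_setOf_isSoluble.isOpen_compl.mem_nhds hs
    filter_upwards [hc] with g hg
    exact iff_of_false hg hs

/-- **Congruence form.** If `Δ(f) ≠ 0` there is `k` such that every form `g ≡ f (mod p^k)`
(coefficientwise) is `ℚ_p`-soluble iff `f` is. [cite: BhargavaShankarAnnals2015, §5.1–5.2 (arXiv:1006.1002v2 numbering)] -/
theorem exists_pow_dvd_imp_isSoluble_iff (f : BinaryQuartic ℤ_[p]) (hΔ : f.disc ≠ 0) :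
    ∃ k : ℕ, ∀ g : BinaryQuartic ℤ_[p], (∀ i, (p : ℤ_[p]) ^ k ∣ g.coeffs i - f.coeffs i) →
      ((g.map PadicInt.Coe.ringHom).IsSoluble ↔ (f.map PadicInt.Coe.ringHom).IsSoluble) := by
  have h := eventually_isSoluble_iff f hΔ
  rw [isInducing_coeffs.nhds_eq_comap, eventually_comap] at h
  obtain ⟨ε, hε, hball⟩ := Metric.eventually_nhds_iff.mp h
  obtain ⟨k, hk⟩ := PadicInt.exists_pow_neg_lt p hε
  refine ⟨k, fun g hg ↦ hball ?_ g rfl⟩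
  refine lt_of_le_of_lt ((dist_pi_le_iff (zpow_nonneg (Nat.cast_nonneg _) _)).mpr fun i ↦ ?_) hk
  rw [dist_eq_norm]
  exact (PadicInt.norm_le_pow_iff_mem_span_pow _ k).mpr (Ideal.mem_span_singleton.mpr (hg i))

/-- Coefficients commute with change of ring. [folklore] -/
theorem coeffs_map {R S : Type*} [CommRing R] [CommRing S] (φ : R →+* S) (f : BinaryQuartic R)
    (i : Fin 5) : (f.map φ).coeffs i = φ (f.coeffs i) := by
  fin_cases i <;> rfl

/-- `ℤ → ℤ_p → ℚ_p` is `ℤ → ℚ_p` on forms. [folklore] -/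
theorem map_intCast_map_coe (f : BinaryQuartic ℤ) :
    (f.map (Int.castRingHom ℤ_[p])).map PadicInt.Coe.ringHom = f.map (Int.castRingHom ℚ_[p]) := by
  ext <;> simp [map]

/-- **Congruence form for integral forms.** If `f ∈ V_ℤ` has `Δ(f) ≠ 0` there is `k` such that every
integral `g ≡ f (mod p^k)` is `ℚ_p`-soluble iff `f` is — `ℚ_p`-solubility of an integral form being
the `p`-component `(·.map (Int.castRingHom ℚ_[p])).IsSoluble` of `BinaryQuartic.IsLocallySoluble`.
[cite: BhargavaShankarAnnals2015, §5.1–5.2 (arXiv:1006.1002v2 numbering)] -/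
theorem exists_pow_dvd_imp_isSoluble_iff_int (f : BinaryQuartic ℤ) (hΔ : f.disc ≠ 0) :
    ∃ k : ℕ, ∀ g : BinaryQuartic ℤ, (∀ i, (p : ℤ) ^ k ∣ g.coeffs i - f.coeffs i) →
      ((g.map (Int.castRingHom ℚ_[p])).IsSoluble ↔ (f.map (Int.castRingHom ℚ_[p])).IsSoluble) := by
  have hΔ' : (f.map (Int.castRingHom ℤ_[p])).disc ≠ 0 := by
    rw [disc_map]
    exact Int.cast_ne_zero.mpr hΔ
  obtain ⟨k, hk⟩ := exists_pow_dvd_imp_isSoluble_iff (f.map (Int.castRingHom ℤ_[p])) hΔ'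
  refine ⟨k, fun g hg ↦ ?_⟩
  rw [← map_intCast_map_coe g, ← map_intCast_map_coe f]
  refine hk _ fun i ↦ ?_
  rw [coeffs_map, coeffs_map]
  have := map_dvd (Int.castRingHom ℤ_[p]) (hg i)
  simpa using this

end Padic

end BinaryQuartic

end Literature.NumberTheory.EllipticCurves

end
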